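import Mathlib
import HarnessLib
import Literature.Computability.AlgebraicComplexity.SyndromePolynomial
import Summits.ValiantsHypothesis.ValiantsHypothesis.Theses.ChowBorderDepth3

/-!
# Route ChowBorderDepth3 — Ryser's formula as a LOCAL border expression with `2^n` summands

Support file for item `stmt-ValiantsHypothesis-6916` (`BStableWitnessBound`, informal) of route
`ValiantsHypothesis/ChowBorderDepth3`, calibrating the LENGTH bound of its first rung ("no short
torus-stable smoothable witness at the vertex `x_0^D`", `r ≤ (n+2)^(c⌊√n⌋+c)`) and of
`PolyFanInLocal` (`stmt-ValiantsHypothesis-5937`, `r ≤ n^k + k`): the local Ryser identity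

  `Σ_{S ⊆ [n]} (-1)^(n-|S|) Π_{i<n} (1 + ε Σ_{l ∈ S} x_il) = ε^n · per_n`      (exactly, no `O(ε^(n+1))`)

(`sum_neg_one_pow_mul_prod_one_add`, any commutative ring, any `ε`), i.e. a border expression
`Σ_{i < 2^n} a_i(ε) Π_{j<n} (1 + m_ij(ε))` of `per_n` with ALL linear parts divisible by `ε`, `2^n`
summands and only `D = n` factors (`exists_local_ryser_perPoly`).  Geometrically this is Ryser's
formula read as ONE fat point of length `2^n` at the vertex of the Chow variety `Ch_n` (the image of
`Spec ℂ[t_1,…,t_n]/(t_i^2)` under `t ↦ Π_i (x_0 + Σ_j t_j x_ij)`, the limit of the `2^n` points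
`t ∈ {0, ε}^n`), whose span contains `per_n`: the length bound in the first rung cannot be dropped,
just as the degree bound cannot (`ChowBorderDepth3BStableWitnessBoundLengthTwo.lean`).

Mechanism of the proof: expand `Π_q (1 + ε Σ_{l∈S} y_ql)` over words `w : [n] → Option [n]`
(`none` = take the `1`), swap the sums, `Σ_{S ⊇ im w} (-1)^{|Sᶜ|} = [im w = [n]]`
(`sum_neg_one_pow_card_compl_of_superset`), and the words hitting every `some l` are exactly
`some ∘ σ`, `σ ∈ 𝔖_n`.  No new definitions.

References: H. J. Ryser, *Combinatorial Mathematics*, Carus Monograph 14 (1963), Ch. 2 §4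
(Ryser's formula); J. M. Landsberg, *Geometry and complexity theory*, CUP 2017, §7.2–7.5.
-/

set_option linter.dupNamespace false

namespace Summit.ValiantsHypothesis.ValiantsHypothesis.Theorems

open Summit.ValiantsHypothesis.ValiantsHypothesis.Theses.ChowBorderDepth3

open scoped Polynomial

/-- **Ryser's formula, local (inhomogeneous) form**, over any commutative ring and for any
parameter `t`: `Σ_{S ⊆ [d]} (-1)^(d-|S|) Π_q (1 + t Σ_{l∈S} y_ql) = t^d Σ_{σ ∈ 𝔖_d} Π_q y_{q,σ q}` —
all terms of `t`-degree `< d` cancel.  [cite: Ryser1963, Ch. 2 §4] -/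
theorem sum_neg_one_pow_mul_prod_one_add {K : Type*} [CommRing K] {d : ℕ} (t : K)
    (y : Fin d → Fin d → K) :
    ∑ S : Finset (Fin d), (-1 : K) ^ (d - S.card) * ∏ q, (1 + t * ∑ l ∈ S, y q l) =
      t ^ d * ∑ σ : Equiv.Perm (Fin d), ∏ q, y q (σ q) := by
  classical
  -- expand the products over words `w : Fin d → Option (Fin d)` (`none` ↦ `1`, `some l` ↦ `t y_ql`)
  have hexp : ∀ S : Finset (Fin d), ∏ q, (1 + t * ∑ l ∈ S, y q l) =
      ∑ w : Fin d → Option (Fin d),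
        if (∀ q, w q ∈ Finset.insertNone S) then ∏ q, (w q).elim 1 (fun l => t * y q l) else 0 := by
    intro S
    have h1 : ∀ q, (1 + t * ∑ l ∈ S, y q l) =
        ∑ o ∈ Finset.insertNone S, o.elim 1 (fun l => t * y q l) := by
      intro q
      rw [Finset.sum_insertNone, Finset.mul_sum]
      rfl
    simp_rw [h1]
    rw [Finset.prod_univ_sum, ← Finset.sum_filter]
    refine Finset.sum_congr ?_ fun w _ => rfl
    ext w
    simp [Fintype.mem_piFinset]
  -- membership in terms of the set of letters `some l` used by `w`
  have hR : ∀ (w : Fin d → Option (Fin d)) (S : Finset (Fin d)),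
      (∀ q, w q ∈ Finset.insertNone S) ↔ Finset.eraseNone (Finset.univ.image w) ⊆ S := by
    intro w S
    constructor
    · intro h a ha
      rw [Finset.mem_eraseNone, Finset.mem_image] at ha
      obtain ⟨q, _, hq⟩ := ha
      exact Finset.mem_insertNone.1 (h q) a (Option.mem_def.2 hq)
    · intro h q
      rw [Finset.mem_insertNone]
      intro a ha
      apply h
      rw [Finset.mem_eraseNone, Finset.mem_image]
      exact ⟨q, Finset.mem_univ _, Option.mem_def.1 ha⟩
  have hcard : ∀ S : Finset (Fin d), d - S.card = Sᶜ.card := fun S => by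
    rw [Finset.card_compl, Fintype.card_fin]
  simp_rw [hexp, hcard, Finset.mul_sum, mul_ite, mul_zero]
  rw [Finset.sum_comm]
  -- the inner sum over `S ⊇ letters(w)` is `[letters(w) = univ] · Π_q …`
  have hinner : ∀ w : Fin d → Option (Fin d),
      ∑ S : Finset (Fin d), (if (∀ q, w q ∈ Finset.insertNone S) then
          (-1 : K) ^ Sᶜ.card * ∏ q, (w q).elim 1 (fun l => t * y q l) else 0) =
        if Finset.eraseNone (Finset.univ.image w) = Finset.univ then
          ∏ q, (w q).elim 1 (fun l => t * y q l) else 0 := by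
    intro w
    have hfac : ∀ S : Finset (Fin d),
        (if (∀ q, w q ∈ Finset.insertNone S) then
            (-1 : K) ^ Sᶜ.card * ∏ q, (w q).elim 1 (fun l => t * y q l) else 0) =
          (if Finset.eraseNone (Finset.univ.image w) ⊆ S then (-1 : K) ^ Sᶜ.card else 0) *
            ∏ q, (w q).elim 1 (fun l => t * y q l) := by
      intro S
      by_cases h : ∀ q, w q ∈ Finset.insertNone S
      · rw [if_pos h, if_pos ((hR w S).1 h)]
      · rw [if_neg h, if_neg (fun h' => h ((hR w S).2 h')), zero_mul]
    simp_rw [hfac]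
    rw [← Finset.sum_mul,
      Literature.Computability.AlgebraicComplexity.sum_neg_one_pow_card_compl_of_superset]
    split_ifs <;> simp
  simp_rw [hinner]
  rw [← Finset.sum_filter]
  symm
  -- the words using every letter `some l` are exactly `some ∘ σ`, `σ` a permutation
  refine Finset.sum_bij (fun σ _ => fun q => some (σ q)) ?_ ?_ ?_ ?_
  · intro σ _
    refine Finset.mem_filter.2 ⟨Finset.mem_univ _, ?_⟩
    ext l
    simp only [Finset.mem_eraseNone, Finset.mem_image, Finset.mem_univ, true_and, Option.some.injEq,
      iff_true]
    exact ⟨σ.symm l, by simp⟩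
  · intro σ₁ _ σ₂ _ h
    exact Equiv.ext fun q => Option.some_injective _ (congr_fun h q)
  · intro w hw
    have hw' := (Finset.mem_filter.1 hw).2
    have hsurj : ∀ l : Fin d, ∃ q, w q = some l := by
      intro l
      have hl : l ∈ Finset.eraseNone (Finset.univ.image w) := by
        rw [hw']
        exact Finset.mem_univ l
      simpa [Finset.mem_eraseNone, Finset.mem_image] using hl
    choose g hg using hsurj
    have hinj : Function.Injective g := by
      intro l₁ l₂ h
      exact Option.some_injective _ ((hg l₁).symm.trans (h ▸ hg l₂))
    have hbij : Function.Bijective g := (Fintype.bijective_iff_injective_and_card g).2 ⟨hinj, rfl⟩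
    refine ⟨(Equiv.ofBijective g hbij).symm, Finset.mem_univ _, ?_⟩
    funext q
    conv_rhs => rw [← Equiv.ofBijective_apply_symm_apply g hbij q]
    exact (hg _).symm
  · intro σ _
    simp [Finset.prod_mul_distrib, Finset.prod_const, Finset.card_univ, Fintype.card_fin]

/-- **Ryser's formula is a local border expression of `per_n` with `2^n` summands and `D = n`
factors** (calibration of the length bound in the first rung of `BStableWitnessBound`,
item stmt-ValiantsHypothesis-6916, and in `PolyFanInLocal`, item stmt-ValiantsHypothesis-5937):
in the exact shape of those items, with `r = 2^n`, `D = n`, `q = n`, `G = 0`,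
`a_S = (-1)^(n-|S|)` and `m_{S,j} = ε · Σ_{l∈S} x_{jl}` (every linear part divisible by `ε`).
[cite: Ryser1963, Ch. 2 §4] -/
theorem exists_local_ryser_perPoly (n : ℕ) :
    ∃ (q : ℕ) (a : Fin (2 ^ n) → ℂ[X]) (m : Fin (2 ^ n) → Fin n → (Fin n × Fin n) → ℂ[X])
      (G : MvPolynomial (Fin n × Fin n) ℂ[X]),
      (∀ i j v, Polynomial.X ∣ m i j v) ∧
      (∑ i, MvPolynomial.C (a i) * ∏ j, (1 + ∑ v, MvPolynomial.C (m i j v) * MvPolynomial.X v)) =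
        MvPolynomial.C (Polynomial.X ^ q) *
            MvPolynomial.map Polynomial.C
              (Literature.Computability.AlgebraicComplexity.perPoly (Fin n) ℂ) +
          MvPolynomial.C (Polynomial.X ^ (q + 1)) * G := by
  classical
  -- index the `2^n` summands by subsets of the columns
  have hcardF : Fintype.card (Finset (Fin n)) = 2 ^ n := by
    rw [Fintype.card_finset, Fintype.card_fin]
  let e : Fin (2 ^ n) ≃ Finset (Fin n) := (Fintype.equivFinOfCardEq hcardF).symm
  refine ⟨n, fun i => (-1) ^ (n - (e i).card),
    fun i j v => if v.1 = j ∧ v.2 ∈ e i then Polynomial.X else 0, 0, ?_, ?_⟩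
  · intro i j v
    show Polynomial.X ∣ (if v.1 = j ∧ v.2 ∈ e i then Polynomial.X else 0)
    split_ifs
    exacts [dvd_rfl, dvd_zero _]
  · -- the linear part of factor `j` of summand `S` is `ε · Σ_{l∈S} x_{jl}`
    have hlin : ∀ (S : Finset (Fin n)) (j : Fin n),
        ∑ v : Fin n × Fin n, MvPolynomial.C (if v.1 = j ∧ v.2 ∈ S then Polynomial.X else 0) *
            MvPolynomial.X v =
          MvPolynomial.C Polynomial.X * ∑ l ∈ S, (MvPolynomial.X (j, l) :
            MvPolynomial (Fin n × Fin n) ℂ[X]) := by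
      intro S j
      have h1 : ∀ v : Fin n × Fin n,
          (MvPolynomial.C (if v.1 = j ∧ v.2 ∈ S then Polynomial.X else 0) * MvPolynomial.X v :
              MvPolynomial (Fin n × Fin n) ℂ[X]) =
            if v.1 = j ∧ v.2 ∈ S then MvPolynomial.C Polynomial.X * MvPolynomial.X v else 0 := by
        intro v
        split_ifs <;> simp
      simp_rw [h1]
      rw [Fintype.sum_prod_type, Finset.sum_eq_single j]
      · simp only [true_and]
        rw [Finset.sum_ite_mem, Finset.univ_inter, Finset.mul_sum]
      · intro i _ hi
        simp [hi]
      · simp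
    -- the permanent over `ℂ[ε]`, rows first
    have hper : MvPolynomial.map Polynomial.C
        (Literature.Computability.AlgebraicComplexity.perPoly (Fin n) ℂ) =
          ∑ σ : Equiv.Perm (Fin n), ∏ q, (MvPolynomial.X (q, σ q) :
            MvPolynomial (Fin n × Fin n) ℂ[X]) := by
      rw [Literature.Computability.AlgebraicComplexity.map_perPoly,
        Literature.Computability.AlgebraicComplexity.perPoly_eq_sum_perm_prod_X]
      exact Fintype.sum_equiv (Equiv.inv (Equiv.Perm (Fin n))) _ _ fun σ => rfl
    -- reindex the summands by subsets and read off the local Ryser identity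
    have hL : ∑ i : Fin (2 ^ n), MvPolynomial.C ((-1 : ℂ[X]) ^ (n - (e i).card)) *
          ∏ j : Fin n, (1 + MvPolynomial.C Polynomial.X *
            ∑ l ∈ e i, (MvPolynomial.X (j, l) : MvPolynomial (Fin n × Fin n) ℂ[X])) =
        ∑ S : Finset (Fin n), (-1 : MvPolynomial (Fin n × Fin n) ℂ[X]) ^ (n - S.card) *
          ∏ j : Fin n, (1 + MvPolynomial.C Polynomial.X * ∑ l ∈ S, MvPolynomial.X (j, l)) := by
      refine Fintype.sum_equiv e _ _ fun i => ?_
      simp only [map_pow, map_neg, map_one]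
    simp_rw [hlin]
    rw [hL, sum_neg_one_pow_mul_prod_one_add, hper, map_pow, mul_zero, add_zero]

end Summit.ValiantsHypothesis.ValiantsHypothesis.Theorems
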